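import Summits.QuantumFields.BalabanUV.Beta.GAN24.WilsonSectorGaugeLegUnfolding
import Summits.QuantumFields.BalabanUV.Beta.GAN24.DataColumnCombRows
import Summits.QuantumFields.BalabanUV.Beta.GAN24.BlockWeightContourCommutation
import Summits.QuantumFields.BalabanUV.Beta.GAN24.LambdaSlotWeightsTwoLevel

/-!
# `BalabanUV.Beta.GAN24.WilsonSectorSourcePairingZero` — binder row G-an2-4 ∕ (CONV-C), the (S) row ∕ (W-γ) one level up, (ε-W) at the BASE level:
# **THE CUBIC-WILSON SECTOR OF `X_1` PER SLOT IN CLOSED FORM — E31's «W»-law as a theorem, with the per-slot (C1′) and (C2′) defects explicit**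
# (G-an2-4 CRUX TEAM (2), seat `b2b-balaban-gan24-formalise-leaf-02` = SUPPLIER side of leaf-06's (C2′)∕`hX` mechanism, gen 61; PART 4b, OFFER O-leaf02-g61-1)

NOT IN PRINT; OUR BOOKKEEPING ([folklore] BY NAME over PART 4a `WilsonSectorGaugeLegUnfolding` (§1 the unfolded Wilson sector, §2 adjointness, §3 the two Fubinis), leaf-06 g49
(T1) `DataColumnCombRows.tsum_curvAdj_curv_mul_colH_eq_stepZero` (the level-0 column pairing: Euler–Lagrange of the data columns at every bond), leaf-06 g46
`RelInvWardPairing.tsum_mul_curvAdj_curv_comm ∕ summable_abs_curv ∕ summable_abs_curvAdj` (self-adjointness of `d*d`), leaf-06 g49 (α) `BlockWeightContourCommutation` (commuting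
a block-constant weight through the contour sum); 0 `def`, 0 cited fact, 0 `def … : Prop`, 0 sorry).
HONEST FRAMING (cell contract, verbatim): «discharging `BetaPertH` makes Bałaban's UV stability UNCONDITIONAL — a real constructive-QFT result; it is NOT the continuum limit and NOT
the Clay problem.»  HONEST DEPENDENCY (verbatim): «continuum YM on T⁴ ⇐ BetaPertH ∧ nine spine estimates (0/9 proved); BetaPertH ⇐ (D1) ∧ (D4) ∧ CAP+tail; G-an2-4 gates asym,
D1 and NE2/3/4.»

WHY (leaf-06 g49 R1 ∕ ENGINE E31 §(B): «W = n^{−D}[½(⟨ψ⁺h, C n⟩ − (C1′)) − ¼(⟨C h, σ_ψ n⟩ + (C2′))]», generic `h, n`, D = 2, 3).  PART 4a §1 gives the Wilson sector of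
`X_1` per slot as `v = colH G₀ Lc l t` against `−½·Ψ⁺·d*d(H₀ n) + ¼·d*d(σ_Ψ ⊙ H₀ n)` (`Ψ = φ ∘ blk`).  At level 0 the data columns satisfy Euler–Lagrange at EVERY bond ((T1)):
the `σ`-term is (T1) §4 + (α) `contourSum_bondSum_mul`; on the `Ψ⁺`-term `d*d` moves onto `Ψ⁺⊙v` (self-adjointness), `H₀ n` unfolds into its data (Fubini), (T1) §4 evaluates
every datum's column, the data re-fold into the multiplier response `C₀ n` (Fubini), and (α) `contourSum_endWeight_mul` splits `𝒬(Ψ⁺ ⊙ v)` into `φ⁺·𝒬v − dφ·EI(v)`.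
* **`hasSum_prod_gaugeLeg_e3OfK_wilsonA_zero`** — AT LEVEL 0 (in-block root, bounded `n`, bounded `φ`; `cH₀ = (stepScale_0·Lc^{d+1})⁻¹`, `C₀ n (κ,Y) = Σ_κ₀ Σ'_u n κ₀ u·colM G₀ Lc κ₀ u κ Y`):
  `Σ'_{(u,x)} Σ_κ Σ_κ₂ n κ u·dzφ κ₂ x·e3OfK Lc G₀ wilsonA l t u x (inl κ)(inl κ₂)`
  `  = cH₀·( −½·Σ'_Y Σ_κ (C₀ n)(κ,Y)·(φ(Y+e_κ)·𝒬_{Lc} v κ Y − (dz φ) κ Y·EI_{Lc} v κ Y) + ¼·Σ'_Y Σ_κ colM G₀ Lc l t κ Y·((φ Y + φ(Y+e_κ))·𝒬_{Lc}(H₀ n) κ Y + (dz φ) κ Y·(BO_{Lc} − EI_{Lc})(H₀ n) κ Y) )`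
  — the per-slot (C1′) (PART 2's object, coefficient `+½·cH₀`) and (C2′) ((δ2b)'s object, `+¼·cH₀`) appear explicitly, `𝒬_{Lc} v`, `𝒬_{Lc}(H₀ n)` symbolic; §2
  **`hasSum_prod_gaugeLeg_e3OfK_wilsonA_zero_ctr`** (centred root) evaluates them by leaf-06 (ε-Λ) (`𝟙[(κ,Y)=(l,t)]·s₀⁻¹`, `s₀⁻¹·n`) = leaf-06's displayed `W₀(l,t; n, φ)`.  READING: at
  the pins `cE = Lc^{d+1}`, `cVH = −Lc^{2(d+1)}∕2` the (C1′) of `cE·(this)` and of `cVH·(PART 2)` cancel (`cE·½·cH₀ + cVH·cH₀·(Lc^{d+1})⁻¹ = 0`); the (η) assembly is NOT here.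
Asserts NO value of any resolvent column beyond the Ward laws quoted in PART 1 and (T1)'s Euler–Lagrange identity; NOTHING of (C2′) ∕ `hX` ∕ (W-γ) at levels ≥ 1 ∕ (INV) ∕ (S)
discharged; NEVER «G-an2-4 closed» as (CONV-C); NOT D1, NOT `BetaPertH`, NOT continuum, NOT Clay.  2026-08-23; no existing file touched.
-/

noncomputable section

open Finset
open scoped BigOperators
open Literature.MathematicalPhysics.QuantumFieldTheory
open Literature.MathematicalPhysics.QuantumFieldTheory.Balaban1983to89
open Literature.MathematicalPhysics.QuantumFieldTheory.Balaban1983to89.Beta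
open LatticeForm (quo)
open B12Sec2to5 (l1 l1_nonneg)
open ExpKernelCalculus (Site MKer Decays Zl summable_exp_shift')
open OneStepResolventKernel (Fib LocStencil)
open AffineAveraging (Form0 Form1 box toSite unitVec unitVec_apply dz curv curvAdj contourSum)
open AffineReproduction (contourSumAdj)
open KKTFluctuationEnergy (contourSumAdj_eq)
open AveragingContours (blk)
open AveragingContoursRooted (ctrOff)
open OneStepKernelFamily (KInvStep colH)
open SecondOrderResponse (colM)
open StepJetData (wilsonA locStencil_wilsonA wBound)
open Summit.QuantumFields.BalabanUV.Beta.AxialDressingRooted (coDressKBmAt one_le_of_neZero)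
open Summit.QuantumFields.BalabanUV.Beta.BorderedHessian (stepScale)
open Summit.QuantumFields.BalabanUV.Beta.SpineRooted (e3OfK)
open Summit.QuantumFields.BalabanUV.Beta.GAN24.RelInvWardPairing (summable_bdd_mul)
open Summit.QuantumFields.BalabanUV.Beta.GAN24.CombFreeGaugeLegCharges (hasSum_prod_wilsonA_gaugeLeg)
open Summit.QuantumFields.BalabanUV.Beta.GAN24.CubicPushGaugeLegUnfoldingFF (hasSum_prod_gaugeLeg_e3OfK_ff)

open Summit.QuantumFields.BalabanUV.Beta.GAN24.WilsonSectorGaugeLegUnfolding (hasSum_prod_gaugeLeg_e3OfK_wilsonA summable_abs_contourSum summable_abs_partialContour summable_abs_mul_colH tsum_fieldResponse_mul_eq tsum_multResponse_mul_eq)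

namespace Summit.QuantumFields.BalabanUV.Beta.GAN24.WilsonSectorSourcePairingZero

variable {d : ℕ}

/-! ## §1 Level `0`: the cubic-Wilson sector in closed form (Euler–Lagrange of the data columns, adjointness, block-weight commutation) -/

section Step
variable {Lc : ℕ} [NeZero Lc] {r : Fin (d + 1) → ℕ}

/-- NOT IN PRINT; OUR BOOKKEEPING.  **THE CUBIC-WILSON SECTOR OF `X_1` PER SLOT, CLOSED FORM** (level `0`: `G₀ = coDressKBmAt ρ Lc (KInvStep Lc 0)`, in-block root, bounded `n`,
bounded coarse potential `φ`; `cH₀ = (stepScale_0·Lc^{d+1})⁻¹`; `v = colH G₀ Lc l t` the slot's response column, `H₀ n (κ″,y) = Σ_κ Σ'_u n κ u·colH G₀ Lc κ u κ″ y`,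
`C₀ n (κ,Y) = Σ_κ₀ Σ'_u n κ₀ u·colM G₀ Lc κ₀ u κ Y`; `EI ∕ BO` in (α)'s letters):
`Σ'_{(u,x)} Σ_κ Σ_κ₂ n κ u·dzφ κ₂ x·e3OfK Lc G₀ wilsonA l t u x (inl κ)(inl κ₂)`
`  = cH₀·( −½·Σ'_Y Σ_κ (C₀ n)(κ,Y)·(φ(Y+e_κ)·𝒬_{Lc} v κ Y − (dz φ) κ Y·EI_{Lc} v κ Y) + ¼·Σ'_Y Σ_κ colM G₀ Lc l t κ Y·((φ Y + φ(Y+e_κ))·𝒬_{Lc}(H₀ n) κ Y + (dz φ) κ Y·(BO_{Lc} − EI_{Lc})(H₀ n) κ Y) )`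
— ENGINE E31's «W»-law as a theorem: §1, then on the `σ`-term (T1) `tsum_curvAdj_curv_mul_colH_eq_stepZero` + (α) `contourSum_bondSum_mul`; on the `Ψ⁺`-term `d*d`-adjointness
(`RelInvWardPairing.tsum_mul_curvAdj_curv_comm`), the data Fubini §3, (T1) §4 at every datum, the multiplier Fubini §3 and (α) `contourSum_endWeight_mul`.  The two `dz φ`-terms are the
per-slot (C1′) (`Σ'Σ (C₀n)·dφ·EI v` — PART 2's border-sector object) and (C2′) (`Σ'Σ colM G₀(l,t)·dφ·(BO−EI)(H₀ n)` — (δ2b)'s object); `𝒬_{Lc} v` and `𝒬_{Lc}(H₀ n)` are left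
symbolic (leaf-06 (ε-Λ) `LambdaSlotWeightsTwoLevel.contourSum_colH_eq_ite ∕ contourSum_fieldResponse` evaluate them to `𝟙[(κ,Y)=(l,t)]·stepScale⁻¹` and `stepScale⁻¹·n`). -/
theorem hasSum_prod_gaugeLeg_e3OfK_wilsonA_zero (hr : r ∈ box (d + 1) Lc) (l : Fin (d + 1)) (t : Site (d + 1))
    {n : Form1 (d + 1) ℝ} {Bn : ℝ} (hn : ∀ κ u, |n κ u| ≤ Bn) {φ : Site (d + 1) → ℝ} {Bφ : ℝ} (hφ : ∀ y, |φ y| ≤ Bφ) :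
    HasSum (fun ux : Site (d + 1) × Site (d + 1) => ∑ κ, ∑ κ₂, n κ ux.1 * dz φ κ₂ ux.2 *
        e3OfK Lc (coDressKBmAt (toSite r) Lc (KInvStep (d := d) Lc 0)) (wilsonA d) l t ux.1 ux.2 (Sum.inl κ) (Sum.inl κ₂))
      ((stepScale d Lc 0 * (Lc : ℝ) ^ (d + 1))⁻¹ *
        (-(1 / 2 : ℝ) * ∑' Y : Site (d + 1), ∑ κ : Fin (d + 1),
            (∑ κ₀, ∑' u : Site (d + 1), n κ₀ u * colM (coDressKBmAt (toSite r) Lc (KInvStep (d := d) Lc 0)) Lc κ₀ u κ Y)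
              * (φ (Y + unitVec κ) * contourSum Lc (colH (coDressKBmAt (toSite r) Lc (KInvStep (d := d) Lc 0)) Lc l t) κ Y
                - dz φ κ Y * ∑ b ∈ box (d + 1) Lc, ∑ s ∈ Finset.range Lc, (if b κ + s + 1 < Lc then
                    colH (coDressKBmAt (toSite r) Lc (KInvStep (d := d) Lc 0)) Lc l t κ ((Lc : ℤ) • Y + toSite b + (s : ℤ) • unitVec κ) else 0))
          + (1 / 4 : ℝ) * ∑' Y : Site (d + 1), ∑ κ : Fin (d + 1),
            colM (coDressKBmAt (toSite r) Lc (KInvStep (d := d) Lc 0)) Lc l t κ Y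
              * ((φ Y + φ (Y + unitVec κ))
                  * contourSum Lc (fun κ'' y => ∑ κ₀, ∑' u : Site (d + 1), n κ₀ u * colH (coDressKBmAt (toSite r) Lc (KInvStep (d := d) Lc 0)) Lc κ₀ u κ'' y) κ Y
                + dz φ κ Y * ((∑ b ∈ box (d + 1) Lc, ∑ s ∈ Finset.range Lc, (if Lc ≤ b κ + s then
                      (∑ κ₀, ∑' u : Site (d + 1), n κ₀ u * colH (coDressKBmAt (toSite r) Lc (KInvStep (d := d) Lc 0)) Lc κ₀ u κ ((Lc : ℤ) • Y + toSite b + (s : ℤ) • unitVec κ)) else 0))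
                  - ∑ b ∈ box (d + 1) Lc, ∑ s ∈ Finset.range Lc, (if b κ + s + 1 < Lc then
                      (∑ κ₀, ∑' u : Site (d + 1), n κ₀ u * colH (coDressKBmAt (toSite r) Lc (KInvStep (d := d) Lc 0)) Lc κ₀ u κ ((Lc : ℤ) • Y + toSite b + (s : ℤ) • unitVec κ)) else 0))))) := by
  classical
  have hLc : 1 ≤ Lc := one_le_of_neZero Lc
  set cH : ℝ := (stepScale d Lc 0 * (Lc : ℝ) ^ (d + 1))⁻¹ with hcH
  obtain ⟨δ, C, hδ, -, hK⟩ := OneStepKernelFamily.decays_KInvStep (d := d) (Lc := Lc) 0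
  obtain ⟨δG, CG, hδG, hCG, hG⟩ := Summit.QuantumFields.BalabanUV.Beta.AxialDressingRooted.decays_coDressKBmAt hLc hr (K := KInvStep (d := d) Lc 0)
    ⟨δ, C, hδ, hK.nonneg (Sum.inl 0), hK⟩
  have hBn : 0 ≤ Bn := (abs_nonneg _).trans (hn 0 0)
  have hBφ : 0 ≤ Bφ := (abs_nonneg _).trans (hφ 0)
  -- the objects
  set v : Form1 (d + 1) ℝ := fun κ' u' => colH (coDressKBmAt (toSite r) Lc (KInvStep (d := d) Lc 0)) Lc l t κ' u' with hv
  set Hn : Form1 (d + 1) ℝ := fun κ'' y => ∑ κ₀, ∑' u : Site (d + 1), n κ₀ u * colH (coDressKBmAt (toSite r) Lc (KInvStep (d := d) Lc 0)) Lc κ₀ u κ'' y with hHn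
  set Pv : Form1 (d + 1) ℝ := fun κ' u' => φ (blk Lc (u' + unitVec κ')) * v κ' u' with hPv
  set SH : Form1 (d + 1) ℝ := fun κ'' y => (φ (blk Lc y) + φ (blk Lc (y + unitVec κ''))) * Hn κ'' y with hSH
  -- bounds
  obtain ⟨BH, hBH0, hHb⟩ := Summit.QuantumFields.BalabanUV.Beta.GAN24.CubicPushGaugeLegUnfoldingFF.abs_fieldResponse_le' (d := d) hr 0 hn
  have hHnb : ∀ κ u, |Hn κ u| ≤ BH := fun κ u => hHb κ u
  have hvb : ∀ κ u, |v κ u| ≤ CG := fun κ u => by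
    refine (hG _ _ _ _).trans ?_
    have h1 : Real.exp (-δG * l1 (u - (Lc : ℤ) • t)) ≤ 1 := Real.exp_le_one_iff.2 (by have := l1_nonneg (u - (Lc : ℤ) • t); nlinarith)
    exact (mul_le_mul_of_nonneg_left h1 hCG).trans (le_of_eq (mul_one _))
  have hPvb : ∀ κ u, |Pv κ u| ≤ Bφ * CG := fun κ u => by
    simp only [hPv]; rw [abs_mul]; exact mul_le_mul (hφ _) (hvb κ u) (abs_nonneg _) hBφ
  have hSHb : ∀ κ u, |SH κ u| ≤ 2 * Bφ * BH := fun κ u => by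
    simp only [hSH]; rw [abs_mul]
    have h1 : |φ (blk Lc u) + φ (blk Lc (u + unitVec κ))| ≤ 2 * Bφ := (abs_add_le _ _).trans (by linarith [hφ (blk Lc u), hφ (blk Lc (u + unitVec κ))])
    exact mul_le_mul h1 (hHnb κ u) (abs_nonneg _) (by positivity)
  set BA : ℝ := (d + 1 : ℕ) * (2 * (4 * BH)) + (d + 1 : ℕ) * (2 * (4 * BH)) with hBA
  have hAb : ∀ κ u, |curvAdj (curv Hn) κ u| ≤ BA := fun κ u =>
    Summit.QuantumFields.BalabanUV.Beta.GAN24.CombFreeGaugeLegCharges.abs_curvAdj_curv_le hHnb κ u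
  set BB : ℝ := (d + 1 : ℕ) * (2 * (4 * (2 * Bφ * BH))) + (d + 1 : ℕ) * (2 * (4 * (2 * Bφ * BH))) with hBB
  have hBb : ∀ κ u, |curvAdj (curv SH) κ u| ≤ BB := fun κ u =>
    Summit.QuantumFields.BalabanUV.Beta.GAN24.CombFreeGaugeLegCharges.abs_curvAdj_curv_le hSHb κ u
  -- summabilities along the slot column
  have hsA : ∀ κ', Summable fun u' : Site (d + 1) => v κ' u' * (φ (blk Lc (u' + unitVec κ')) * curvAdj (curv Hn) κ' u') := by
    intro κ'
    have hw : ∀ κ u, |φ (blk Lc (u + unitVec κ)) * curvAdj (curv Hn) κ u| ≤ Bφ * BA := fun κ u => by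
      rw [abs_mul]; exact mul_le_mul (hφ _) (hAb κ u) (abs_nonneg _) hBφ
    have h := summable_abs_mul_colH (d := d) hr 0 l t hw κ'
    exact (Summable.of_abs h).congr fun u' => by simp only [hv]; ring
  have hsB : ∀ κ', Summable fun u' : Site (d + 1) => v κ' u' * curvAdj (curv SH) κ' u' := by
    intro κ'
    have h := summable_abs_mul_colH (d := d) hr 0 l t hBb κ'
    exact (Summable.of_abs h).congr fun u' => by simp only [hv]; ring
  have hPvs : ∀ κ', Summable fun u' : Site (d + 1) => |Pv κ' u'| := by
    intro κ'
    have hw : ∀ (κ : Fin (d + 1)) (u : Site (d + 1)), |φ (blk Lc (u + unitVec κ))| ≤ Bφ := fun κ u => hφ _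
    exact (summable_abs_mul_colH (d := d) hr 0 l t hw κ').congr fun u' => by simp only [hPv, hv]
  -- §1 at level 0
  have h1 := hasSum_prod_gaugeLeg_e3OfK_wilsonA (d := d) hr 0 l t hn hφ
  -- SPLIT the slot series
  have hsplit : (∑ κ', ∑' u' : Site (d + 1), colH (coDressKBmAt (toSite r) Lc (KInvStep (d := d) Lc 0)) Lc l t κ' u' *
        (-(1 / 2 : ℝ) * φ (blk Lc (u' + unitVec κ')) * curvAdj (curv Hn) κ' u' + (1 / 4 : ℝ) * curvAdj (curv SH) κ' u'))
      = -(1 / 2 : ℝ) * (∑' u' : Site (d + 1), ∑ κ', Pv κ' u' * curvAdj (curv Hn) κ' u')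
        + (1 / 4 : ℝ) * (∑' u' : Site (d + 1), ∑ κ', curvAdj (curv SH) κ' u' * v κ' u') := by
    have e1 : ∀ κ', (∑' u' : Site (d + 1), colH (coDressKBmAt (toSite r) Lc (KInvStep (d := d) Lc 0)) Lc l t κ' u' *
          (-(1 / 2 : ℝ) * φ (blk Lc (u' + unitVec κ')) * curvAdj (curv Hn) κ' u' + (1 / 4 : ℝ) * curvAdj (curv SH) κ' u'))
        = -(1 / 2 : ℝ) * (∑' u' : Site (d + 1), Pv κ' u' * curvAdj (curv Hn) κ' u') + (1 / 4 : ℝ) * (∑' u' : Site (d + 1), curvAdj (curv SH) κ' u' * v κ' u') := by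
      intro κ'
      have ha := (hsA κ').mul_left (-(1 / 2 : ℝ))
      have hb := (hsB κ').mul_left (1 / 4 : ℝ)
      rw [show (fun u' : Site (d + 1) => colH (coDressKBmAt (toSite r) Lc (KInvStep (d := d) Lc 0)) Lc l t κ' u' *
            (-(1 / 2 : ℝ) * φ (blk Lc (u' + unitVec κ')) * curvAdj (curv Hn) κ' u' + (1 / 4 : ℝ) * curvAdj (curv SH) κ' u'))
          = fun u' => -(1 / 2 : ℝ) * (v κ' u' * (φ (blk Lc (u' + unitVec κ')) * curvAdj (curv Hn) κ' u')) + (1 / 4 : ℝ) * (v κ' u' * curvAdj (curv SH) κ' u') from by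
        funext u'; simp only [hv]; ring]
      rw [ha.tsum_add hb, tsum_mul_left, tsum_mul_left]
      congr 1
      · congr 1; exact tsum_congr fun u' => by simp only [hPv]; ring
      · congr 1; exact tsum_congr fun u' => by ring
    rw [Finset.sum_congr rfl (fun κ' _ => e1 κ'), Finset.sum_add_distrib, ← Finset.mul_sum, ← Finset.mul_sum]
    congr 1
    · congr 1
      rw [Summable.tsum_finsetSum (fun κ' _ => ?_)]
      exact ((hsA κ').congr fun u' => by simp only [hPv]; ring)
    · congr 1
      rw [Summable.tsum_finsetSum (fun κ' _ => ?_)]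
      exact ((hsB κ').congr fun u' => by ring)
  -- the σ-term: (T1) Ward pairing + (α)
  have hT2 : (∑' u' : Site (d + 1), ∑ κ', curvAdj (curv SH) κ' u' * v κ' u')
      = ∑' Y : Site (d + 1), ∑ κ, colM (coDressKBmAt (toSite r) Lc (KInvStep (d := d) Lc 0)) Lc l t κ Y * ((φ Y + φ (Y + unitVec κ)) * contourSum Lc Hn κ Y
          + dz φ κ Y * ((∑ b ∈ box (d + 1) Lc, ∑ s ∈ Finset.range Lc, (if Lc ≤ b κ + s then Hn κ ((Lc : ℤ) • Y + toSite b + (s : ℤ) • unitVec κ) else 0))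
            - ∑ b ∈ box (d + 1) Lc, ∑ s ∈ Finset.range Lc, (if b κ + s + 1 < Lc then Hn κ ((Lc : ℤ) • Y + toSite b + (s : ℤ) • unitVec κ) else 0))) := by
    have h := Summit.QuantumFields.BalabanUV.Beta.GAN24.DataColumnCombRows.tsum_curvAdj_curv_mul_colH_eq_stepZero (d := d) hr (m := SH) hSHb l t
    simp only [hv]
    rw [h]
    refine tsum_congr fun Y => Finset.sum_congr rfl fun κ _ => ?_
    rw [show contourSum Lc SH κ Y = contourSum Lc (fun κ' u => (φ (blk Lc u) + φ (blk Lc (u + unitVec κ'))) * Hn κ' u) κ Y from rfl,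
      Summit.QuantumFields.BalabanUV.Beta.GAN24.BlockWeightContourCommutation.contourSum_bondSum_mul hLc φ Hn κ Y]
    ring
  -- the Ψ⁺-term: adjointness of `d*d`, data Fubini, (T1) §4 per datum, multiplier Fubini, (α)
  have hT1 : (∑' u' : Site (d + 1), ∑ κ', Pv κ' u' * curvAdj (curv Hn) κ' u')
      = ∑' Y : Site (d + 1), ∑ κ, (∑ κ₀, ∑' u : Site (d + 1), n κ₀ u * colM (coDressKBmAt (toSite r) Lc (KInvStep (d := d) Lc 0)) Lc κ₀ u κ Y)
          * (φ (Y + unitVec κ) * contourSum Lc v κ Y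
            - dz φ κ Y * ∑ b ∈ box (d + 1) Lc, ∑ s ∈ Finset.range Lc, (if b κ + s + 1 < Lc then v κ ((Lc : ℤ) • Y + toSite b + (s : ℤ) • unitVec κ) else 0)) := by
    -- `d*d` onto `Pv`
    have hc := Summit.QuantumFields.BalabanUV.Beta.GAN24.RelInvWardPairing.tsum_mul_curvAdj_curv_comm (m := Hn) (A := Pv) hHnb hPvs
    have e0 : (∑' u' : Site (d + 1), ∑ κ', Pv κ' u' * curvAdj (curv Hn) κ' u') = ∑' u' : Site (d + 1), ∑ κ', Hn κ' u' * curvAdj (curv Pv) κ' u' := by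
      rw [hc]; exact tsum_congr fun u' => Finset.sum_congr rfl fun κ' _ => mul_comm _ _
    rw [e0]
    -- `D := d*d Pv` is absolutely summable
    have hD : ∀ κ', Summable fun u' : Site (d + 1) => |curvAdj (curv Pv) κ' u'| := fun κ' =>
      Summit.QuantumFields.BalabanUV.Beta.GAN24.RelInvWardPairing.summable_abs_curvAdj
        (fun κ l => Summit.QuantumFields.BalabanUV.Beta.GAN24.RelInvWardPairing.summable_abs_curv hPvs κ l) κ'
    -- data Fubini
    have eF1 := tsum_fieldResponse_mul_eq (d := d) hr 0 hn hD
    simp only [hHn]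
    rw [eF1]
    -- (T1) §4 per datum `(κ₀, u)`, `m := Pv` bounded
    have eW : ∀ (κ₀ : Fin (d + 1)) (u : Site (d + 1)),
        (∑' u' : Site (d + 1), ∑ κ', curvAdj (curv Pv) κ' u' * colH (coDressKBmAt (toSite r) Lc (KInvStep (d := d) Lc 0)) Lc κ₀ u κ' u') = ∑' Y : Site (d + 1), ∑ κ, contourSum Lc Pv κ Y * colM (coDressKBmAt (toSite r) Lc (KInvStep (d := d) Lc 0)) Lc κ₀ u κ Y :=
      fun κ₀ u => Summit.QuantumFields.BalabanUV.Beta.GAN24.DataColumnCombRows.tsum_curvAdj_curv_mul_colH_eq_stepZero (d := d) hr (m := Pv) hPvb κ₀ u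
    simp only [eW]
    -- multiplier Fubini
    have hQ : ∀ κ, Summable fun Y : Site (d + 1) => |contourSum Lc Pv κ Y| := fun κ => summable_abs_contourSum (N := Lc) hPvs κ
    rw [← tsum_multResponse_mul_eq (d := d) hr 0 hn hQ]
    refine tsum_congr fun Y => Finset.sum_congr rfl fun κ _ => ?_
    rw [show contourSum Lc Pv κ Y = contourSum Lc (fun κ' u => φ (blk Lc (u + unitVec κ')) * v κ' u) κ Y from rfl,
      Summit.QuantumFields.BalabanUV.Beta.GAN24.BlockWeightContourCommutation.contourSum_endWeight_mul hLc φ v κ Y]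
  -- assemble
  have hval : (∑ κ', ∑' u' : Site (d + 1), colH (coDressKBmAt (toSite r) Lc (KInvStep (d := d) Lc 0)) Lc l t κ' u' *
        (-(1 / 2 : ℝ) * φ (blk Lc (u' + unitVec κ')) * curvAdj (curv Hn) κ' u' + (1 / 4 : ℝ) * curvAdj (curv SH) κ' u'))
      = -(1 / 2 : ℝ) * (∑' Y : Site (d + 1), ∑ κ, (∑ κ₀, ∑' u : Site (d + 1), n κ₀ u * colM (coDressKBmAt (toSite r) Lc (KInvStep (d := d) Lc 0)) Lc κ₀ u κ Y)
          * (φ (Y + unitVec κ) * contourSum Lc v κ Y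
            - dz φ κ Y * ∑ b ∈ box (d + 1) Lc, ∑ s ∈ Finset.range Lc, (if b κ + s + 1 < Lc then v κ ((Lc : ℤ) • Y + toSite b + (s : ℤ) • unitVec κ) else 0)))
        + (1 / 4 : ℝ) * (∑' Y : Site (d + 1), ∑ κ, colM (coDressKBmAt (toSite r) Lc (KInvStep (d := d) Lc 0)) Lc l t κ Y * ((φ Y + φ (Y + unitVec κ)) * contourSum Lc Hn κ Y
          + dz φ κ Y * ((∑ b ∈ box (d + 1) Lc, ∑ s ∈ Finset.range Lc, (if Lc ≤ b κ + s then Hn κ ((Lc : ℤ) • Y + toSite b + (s : ℤ) • unitVec κ) else 0))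
            - ∑ b ∈ box (d + 1) Lc, ∑ s ∈ Finset.range Lc, (if b κ + s + 1 < Lc then Hn κ ((Lc : ℤ) • Y + toSite b + (s : ℤ) • unitVec κ) else 0)))) := by
    rw [hsplit, hT1, hT2]
  have h2 : HasSum (fun ux : Site (d + 1) × Site (d + 1) => ∑ κ, ∑ κ₂, n κ ux.1 * dz φ κ₂ ux.2 * e3OfK Lc (coDressKBmAt (toSite r) Lc (KInvStep (d := d) Lc 0)) (wilsonA d) l t ux.1 ux.2 (Sum.inl κ) (Sum.inl κ₂))
      (cH * ∑ κ', ∑' u' : Site (d + 1), colH (coDressKBmAt (toSite r) Lc (KInvStep (d := d) Lc 0)) Lc l t κ' u' *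
        (-(1 / 2 : ℝ) * φ (blk Lc (u' + unitVec κ')) * curvAdj (curv Hn) κ' u' + (1 / 4 : ℝ) * curvAdj (curv SH) κ' u')) := by
    simpa only [hHn, hSH] using h1
  rw [hval] at h2
  simpa only [hv, hHn, mul_assoc] using h2

/-! ## §2 Centred root: the contour sums evaluated — leaf-06's displayed `W₀(l,t; n, φ)` -/

/-- NOT IN PRINT; OUR BOOKKEEPING.  **leaf-06's DISPLAYED `W₀(l,t; n, φ)`** (CENTRED root `ρ = toSite (ctrOff (d+1) Lc)`, level `0`, bounded `n`, bounded `φ`; `s₀ = stepScale_0`, `cH₀ = (s₀·Lc^{d+1})⁻¹`,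
`v = colH G₀ Lc l t`, `H₀ n`, `C₀ n` as in §1): the two contour sums of §1 evaluated by leaf-06 g49 (ε-Λ) (`contourSum_colH_eq_ite`: `𝒬v κ Y = 𝟙[(κ,Y) = (l,t)]·s₀⁻¹`;
`contourSum_fieldResponse`: `𝒬(H₀ n) = s₀⁻¹·n`) —
`Σ'_{(u,x)} Σ_κ Σ_κ₂ n κ u·dzφ κ₂ x·e3OfK Lc G₀ wilsonA l t u x (inl κ)(inl κ₂)`
`  = cH₀·( −½·(s₀⁻¹·φ(t+e_l)·(C₀ n)(l,t) − (C1′)_{lt}) + ¼·(s₀⁻¹·Σ'_Y Σ_κ colM G₀ Lc l t κ Y·(φ Y + φ(Y+e_κ))·n κ Y + (C2′)_{lt}) )`,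
`(C1′)_{lt} = Σ'_Y Σ_κ (C₀ n)(κ,Y)·(dz φ) κ Y·EI_{Lc} v κ Y` (PART 2's object), `(C2′)_{lt} = Σ'_Y Σ_κ colM G₀ Lc l t κ Y·(dz φ) κ Y·(BO_{Lc} − EI_{Lc})(H₀ n) κ Y` ((δ2b)'s object)
— i.e. `W₀ = cH₀·[−½ s₀⁻¹ φ(t+e_l)·(C₀ n)(l,t) + ½ (C1′)_{lt} + ¼ s₀⁻¹ ⟨colM G₀(l,t), σ_φ⊙n⟩ + ¼ (C2′)_{lt}]`, E31's «W» per slot. -/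
theorem hasSum_prod_gaugeLeg_e3OfK_wilsonA_zero_ctr (l : Fin (d + 1)) (t : Site (d + 1))
    {n : Form1 (d + 1) ℝ} {Bn : ℝ} (hn : ∀ κ u, |n κ u| ≤ Bn) {φ : Site (d + 1) → ℝ} {Bφ : ℝ} (hφ : ∀ y, |φ y| ≤ Bφ) :
    HasSum (fun ux : Site (d + 1) × Site (d + 1) => ∑ κ, ∑ κ₂, n κ ux.1 * dz φ κ₂ ux.2 *
        e3OfK Lc (coDressKBmAt (toSite (ctrOff (d + 1) Lc)) Lc (KInvStep (d := d) Lc 0)) (wilsonA d) l t ux.1 ux.2 (Sum.inl κ) (Sum.inl κ₂))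
      ((stepScale d Lc 0 * (Lc : ℝ) ^ (d + 1))⁻¹ *
        (-(1 / 2 : ℝ) * ((stepScale d Lc 0)⁻¹ * (φ (t + unitVec l)
              * ∑ κ₀, ∑' u : Site (d + 1), n κ₀ u * colM (coDressKBmAt (toSite (ctrOff (d + 1) Lc)) Lc (KInvStep (d := d) Lc 0)) Lc κ₀ u l t)
            - ∑' Y : Site (d + 1), ∑ κ : Fin (d + 1),
              (∑ κ₀, ∑' u : Site (d + 1), n κ₀ u * colM (coDressKBmAt (toSite (ctrOff (d + 1) Lc)) Lc (KInvStep (d := d) Lc 0)) Lc κ₀ u κ Y)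
                * (dz φ κ Y * ∑ b ∈ box (d + 1) Lc, ∑ s ∈ Finset.range Lc, (if b κ + s + 1 < Lc then
                    colH (coDressKBmAt (toSite (ctrOff (d + 1) Lc)) Lc (KInvStep (d := d) Lc 0)) Lc l t κ ((Lc : ℤ) • Y + toSite b + (s : ℤ) • unitVec κ) else 0)))
          + (1 / 4 : ℝ) * ((stepScale d Lc 0)⁻¹ * (∑' Y : Site (d + 1), ∑ κ : Fin (d + 1),
              colM (coDressKBmAt (toSite (ctrOff (d + 1) Lc)) Lc (KInvStep (d := d) Lc 0)) Lc l t κ Y * ((φ Y + φ (Y + unitVec κ)) * n κ Y))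
            + ∑' Y : Site (d + 1), ∑ κ : Fin (d + 1),
              colM (coDressKBmAt (toSite (ctrOff (d + 1) Lc)) Lc (KInvStep (d := d) Lc 0)) Lc l t κ Y
                * (dz φ κ Y * ((∑ b ∈ box (d + 1) Lc, ∑ s ∈ Finset.range Lc, (if Lc ≤ b κ + s then
                      (∑ κ₀, ∑' u : Site (d + 1), n κ₀ u * colH (coDressKBmAt (toSite (ctrOff (d + 1) Lc)) Lc (KInvStep (d := d) Lc 0)) Lc κ₀ u κ ((Lc : ℤ) • Y + toSite b + (s : ℤ) • unitVec κ)) else 0))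
                  - ∑ b ∈ box (d + 1) Lc, ∑ s ∈ Finset.range Lc, (if b κ + s + 1 < Lc then
                      (∑ κ₀, ∑' u : Site (d + 1), n κ₀ u * colH (coDressKBmAt (toSite (ctrOff (d + 1) Lc)) Lc (KInvStep (d := d) Lc 0)) Lc κ₀ u κ ((Lc : ℤ) • Y + toSite b + (s : ℤ) • unitVec κ)) else 0)))))) := by
  classical
  have hLc : 1 ≤ Lc := one_le_of_neZero Lc
  have hr := AveragingContoursRooted.ctrOff_mem_box (d := d + 1) hLc
  have h1 := hasSum_prod_gaugeLeg_e3OfK_wilsonA_zero (d := d) hr l t hn hφ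
  obtain ⟨δ, C, hδ, -, hK⟩ := OneStepKernelFamily.decays_KInvStep (d := d) (Lc := Lc) 0
  obtain ⟨δG, CG, hδG, hCG, hG⟩ := Summit.QuantumFields.BalabanUV.Beta.AxialDressingRooted.decays_coDressKBmAt hLc hr (K := KInvStep (d := d) Lc 0)
    ⟨δ, C, hδ, hK.nonneg (Sum.inl 0), hK⟩
  have hBn : 0 ≤ Bn := (abs_nonneg _).trans (hn 0 0)
  have hBφ : 0 ≤ Bφ := (abs_nonneg _).trans (hφ 0)
  set v : Form1 (d + 1) ℝ := fun κ' u' => colH (coDressKBmAt (toSite (ctrOff (d + 1) Lc)) Lc (KInvStep (d := d) Lc 0)) Lc l t κ' u' with hv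
  set Hn : Form1 (d + 1) ℝ := fun κ'' y => ∑ κ₀, ∑' u : Site (d + 1), n κ₀ u * colH (coDressKBmAt (toSite (ctrOff (d + 1) Lc)) Lc (KInvStep (d := d) Lc 0)) Lc κ₀ u κ'' y with hHn
  set Cn : Form1 (d + 1) ℝ := fun κ Y => ∑ κ₀, ∑' u : Site (d + 1), n κ₀ u * colM (coDressKBmAt (toSite (ctrOff (d + 1) Lc)) Lc (KInvStep (d := d) Lc 0)) Lc κ₀ u κ Y with hCn
  set EIv : Form1 (d + 1) ℝ := fun κ Y => ∑ b ∈ box (d + 1) Lc, ∑ s ∈ Finset.range Lc, (if b κ + s + 1 < Lc then v κ ((Lc : ℤ) • Y + toSite b + (s : ℤ) • unitVec κ) else 0) with hEIv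
  set U : Form1 (d + 1) ℝ := fun κ Y => (∑ b ∈ box (d + 1) Lc, ∑ s ∈ Finset.range Lc, (if Lc ≤ b κ + s then Hn κ ((Lc : ℤ) • Y + toSite b + (s : ℤ) • unitVec κ) else 0))
      - ∑ b ∈ box (d + 1) Lc, ∑ s ∈ Finset.range Lc, (if b κ + s + 1 < Lc then Hn κ ((Lc : ℤ) • Y + toSite b + (s : ℤ) • unitVec κ) else 0) with hU
  -- the two evaluations
  have eQv : ∀ κ Y, contourSum Lc (colH (coDressKBmAt (toSite (ctrOff (d + 1) Lc)) Lc (KInvStep (d := d) Lc 0)) Lc l t) κ Y = if Y = t ∧ κ = l then (stepScale d Lc 0)⁻¹ else 0 :=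
    fun κ Y => Summit.QuantumFields.BalabanUV.Beta.GAN24.LambdaSlotWeightsTwoLevel.contourSum_colH_eq_ite (d := d) hr 0 l t κ Y
  have eQH : ∀ κ Y, contourSum Lc Hn κ Y = (stepScale d Lc 0)⁻¹ * n κ Y :=
    fun κ Y => Summit.QuantumFields.BalabanUV.Beta.GAN24.LambdaSlotWeightsTwoLevel.contourSum_fieldResponse (d := d) 0 hn κ Y
  -- bounds and summabilities
  set T : ℝ := Real.exp (δG * ((Lc : ℝ) * (d + 1))) * Zl (d + 1) δG with hT
  have hCnb : ∀ κ Y, |Cn κ Y| ≤ ((d + 1 : ℕ) : ℝ) * (Bn * CG * T) := by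
    intro κ Y
    simp only [hCn]
    refine (Finset.abs_sum_le_sum_abs _ _).trans ?_
    calc ∑ κ₀, |∑' u : Site (d + 1), n κ₀ u * colM (coDressKBmAt (toSite (ctrOff (d + 1) Lc)) Lc (KInvStep (d := d) Lc 0)) Lc κ₀ u κ Y| ≤ ∑ _κ₀ : Fin (d + 1), Bn * CG * T := Finset.sum_le_sum fun κ₀ _ => by
            have h := (Summit.QuantumFields.BalabanUV.Beta.GAN24.CubicPushGaugeLegUnfolding.summable_weight_col (N := Lc) hG hδG (ω := n κ₀) (fun u => hn κ₀ u)
              ((Lc : ℤ) • Y) (Sum.inr κ) (Sum.inr κ₀)).2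
            have e : (fun z : Site (d + 1) => (coDressKBmAt (toSite (ctrOff (d + 1) Lc)) Lc (KInvStep (d := d) Lc 0)) ((Lc : ℤ) • Y) ((Lc : ℤ) • z) (Sum.inr κ) (Sum.inr κ₀) * n κ₀ z) = fun u => n κ₀ u * colM (coDressKBmAt (toSite (ctrOff (d + 1) Lc)) Lc (KInvStep (d := d) Lc 0)) Lc κ₀ u κ Y := by
              funext u; rw [mul_comm]; rfl
            rw [e] at h; exact h
      _ = _ := by simp only [Finset.sum_const, Finset.card_univ, Fintype.card_fin, nsmul_eq_mul]
  have hvs : ∀ κ, Summable fun u => |v κ u| := by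
    intro κ
    have h := summable_abs_mul_colH (d := d) hr 0 l t (w := fun _ _ => (1 : ℝ)) (B := 1) (fun _ _ => by simp) κ
    exact h.congr fun u => by simp only [hv, one_mul]
  have hEIs : ∀ κ, Summable fun Y => |EIv κ Y| := fun κ => summable_abs_partialContour (d := d) hLc hvs κ (fun b s => b κ + s + 1 < Lc)
  have hcolMs : ∀ κ, Summable fun Y : Site (d + 1) => colM (coDressKBmAt (toSite (ctrOff (d + 1) Lc)) Lc (KInvStep (d := d) Lc 0)) Lc l t κ Y := fun κ =>
    Summit.QuantumFields.BalabanUV.Beta.GAN24.ChargeTowerLegs.summable_resp_colM (toSite (ctrOff (d + 1) Lc)) 0 l t κ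
  obtain ⟨BH, hBH0, hHb⟩ := Summit.QuantumFields.BalabanUV.Beta.GAN24.CubicPushGaugeLegUnfoldingFF.abs_fieldResponse_le' (d := d) hr 0 hn
  have hHnb : ∀ κ u, |Hn κ u| ≤ BH := fun κ u => hHb κ u
  have hUb : ∀ κ Y, |U κ Y| ≤ 2 * (((box (d + 1) Lc).card : ℝ) * ((Lc : ℝ) * BH)) := by
    intro κ Y
    have hpart : ∀ (Q : (Fin (d + 1) → ℕ) → ℕ → Prop) [∀ b s, Decidable (Q b s)],
        |∑ b ∈ box (d + 1) Lc, ∑ s ∈ Finset.range Lc, (if Q b s then Hn κ ((Lc : ℤ) • Y + toSite b + (s : ℤ) • unitVec κ) else 0)|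
          ≤ ((box (d + 1) Lc).card : ℝ) * ((Lc : ℝ) * BH) := by
      intro Q _
      refine (Finset.abs_sum_le_sum_abs _ _).trans ?_
      calc ∑ b ∈ box (d + 1) Lc, |∑ s ∈ Finset.range Lc, (if Q b s then Hn κ ((Lc : ℤ) • Y + toSite b + (s : ℤ) • unitVec κ) else 0)|
          ≤ ∑ _b ∈ box (d + 1) Lc, (Lc : ℝ) * BH := Finset.sum_le_sum fun b _ => by
            refine (Finset.abs_sum_le_sum_abs _ _).trans ?_
            calc ∑ s ∈ Finset.range Lc, |(if Q b s then Hn κ ((Lc : ℤ) • Y + toSite b + (s : ℤ) • unitVec κ) else 0)|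
                ≤ ∑ _s ∈ Finset.range Lc, BH := Finset.sum_le_sum fun s _ => by
                  split_ifs
                  · exact hHnb _ _
                  · rw [abs_zero]; exact hBH0
              _ = (Lc : ℝ) * BH := by rw [Finset.sum_const, Finset.card_range, nsmul_eq_mul]
        _ = _ := by rw [Finset.sum_const, nsmul_eq_mul]
    simp only [hU]
    refine (abs_sub _ _).trans ?_
    have h1 := hpart (fun b s => Lc ≤ b κ + s)
    have h2 := hpart (fun b s => b κ + s + 1 < Lc)
    linarith
  have hdzb : ∀ κ Y, |dz φ κ Y| ≤ 2 * Bφ := KKTFluctuationEnergy.abs_dz_le hφ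
  -- T1-side: split `Cn·(φ⁺·𝒬v − dφ·EI v)` and evaluate the Kronecker
  have sA1 : Summable fun Y : Site (d + 1) => ∑ κ, Cn κ Y * (φ (Y + unitVec κ) * contourSum Lc (colH (coDressKBmAt (toSite (ctrOff (d + 1) Lc)) Lc (KInvStep (d := d) Lc 0)) Lc l t) κ Y) := by
    refine summable_of_ne_finset_zero (s := {t}) fun Y hY => ?_
    rw [Finset.mem_singleton] at hY
    refine Finset.sum_eq_zero fun κ _ => ?_
    rw [eQv, if_neg (fun h => hY h.1), mul_zero, mul_zero]
  have sA2 : Summable fun Y : Site (d + 1) => ∑ κ, Cn κ Y * (dz φ κ Y * EIv κ Y) := by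
    refine summable_sum fun κ _ => ?_
    have hw : ∀ Y, |Cn κ Y * dz φ κ Y| ≤ (((d + 1 : ℕ) : ℝ) * (Bn * CG * T)) * (2 * Bφ) := fun Y => by
      rw [abs_mul]; exact mul_le_mul (hCnb κ Y) (hdzb κ Y) (abs_nonneg _) ((abs_nonneg _).trans (hCnb κ Y))
    exact (summable_bdd_mul (f := fun Y => Cn κ Y * dz φ κ Y) hw (hEIs κ)).congr fun Y => by ring
  have eA : (∑' Y : Site (d + 1), ∑ κ, Cn κ Y * (φ (Y + unitVec κ) * contourSum Lc (colH (coDressKBmAt (toSite (ctrOff (d + 1) Lc)) Lc (KInvStep (d := d) Lc 0)) Lc l t) κ Y - dz φ κ Y * EIv κ Y))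
      = (stepScale d Lc 0)⁻¹ * (φ (t + unitVec l) * Cn l t) - ∑' Y : Site (d + 1), ∑ κ, Cn κ Y * (dz φ κ Y * EIv κ Y) := by
    have e1 : ∀ Y, (∑ κ, Cn κ Y * (φ (Y + unitVec κ) * contourSum Lc (colH (coDressKBmAt (toSite (ctrOff (d + 1) Lc)) Lc (KInvStep (d := d) Lc 0)) Lc l t) κ Y - dz φ κ Y * EIv κ Y))
        = (∑ κ, Cn κ Y * (φ (Y + unitVec κ) * contourSum Lc (colH (coDressKBmAt (toSite (ctrOff (d + 1) Lc)) Lc (KInvStep (d := d) Lc 0)) Lc l t) κ Y)) - ∑ κ, Cn κ Y * (dz φ κ Y * EIv κ Y) := fun Y => by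
      rw [← Finset.sum_sub_distrib]; exact Finset.sum_congr rfl fun κ _ => by ring
    rw [tsum_congr e1, sA1.tsum_sub sA2]
    congr 1
    rw [tsum_eq_single t (fun Y hY => Finset.sum_eq_zero fun κ _ => by rw [eQv, if_neg (fun h => hY h.1), mul_zero, mul_zero])]
    rw [Finset.sum_eq_single l (fun κ _ hκ => by rw [eQv, if_neg (fun h => hκ h.2), mul_zero, mul_zero]) (fun h => absurd (Finset.mem_univ l) h)]
    rw [eQv, if_pos ⟨rfl, rfl⟩]
    ring
  -- T2-side: split `colM·(σ·𝒬(Hn) + dφ·U)` and evaluate `𝒬(Hn)`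
  have sB1 : Summable fun Y : Site (d + 1) => ∑ κ, colM (coDressKBmAt (toSite (ctrOff (d + 1) Lc)) Lc (KInvStep (d := d) Lc 0)) Lc l t κ Y * ((φ Y + φ (Y + unitVec κ)) * contourSum Lc Hn κ Y) := by
    refine summable_sum fun κ _ => ?_
    have hw : ∀ Y, |(φ Y + φ (Y + unitVec κ)) * contourSum Lc Hn κ Y| ≤ 2 * Bφ * (|(stepScale d Lc 0)⁻¹| * Bn) := fun Y => by
      rw [eQH, abs_mul, abs_mul]
      have h1 : |φ Y + φ (Y + unitVec κ)| ≤ 2 * Bφ := (abs_add_le _ _).trans (by linarith [hφ Y, hφ (Y + unitVec κ)])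
      exact mul_le_mul h1 (mul_le_mul_of_nonneg_left (hn κ Y) (abs_nonneg _)) (by positivity) (by positivity)
    exact (Summit.QuantumFields.BalabanUV.Beta.GAN24.CoarseGaugeSourceResponse.summable_bdd_mul (hcolMs κ) hw).congr fun Y => by ring
  have sB2 : Summable fun Y : Site (d + 1) => ∑ κ, colM (coDressKBmAt (toSite (ctrOff (d + 1) Lc)) Lc (KInvStep (d := d) Lc 0)) Lc l t κ Y * (dz φ κ Y * U κ Y) := by
    refine summable_sum fun κ _ => ?_
    have hw : ∀ Y, |dz φ κ Y * U κ Y| ≤ 2 * Bφ * (2 * (((box (d + 1) Lc).card : ℝ) * ((Lc : ℝ) * BH))) := fun Y => by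
      rw [abs_mul]; exact mul_le_mul (hdzb κ Y) (hUb κ Y) (abs_nonneg _) (by positivity)
    exact (Summit.QuantumFields.BalabanUV.Beta.GAN24.CoarseGaugeSourceResponse.summable_bdd_mul (hcolMs κ) hw).congr fun Y => by ring
  have eB : (∑' Y : Site (d + 1), ∑ κ, colM (coDressKBmAt (toSite (ctrOff (d + 1) Lc)) Lc (KInvStep (d := d) Lc 0)) Lc l t κ Y * ((φ Y + φ (Y + unitVec κ)) * contourSum Lc Hn κ Y + dz φ κ Y * U κ Y))
      = (stepScale d Lc 0)⁻¹ * (∑' Y : Site (d + 1), ∑ κ, colM (coDressKBmAt (toSite (ctrOff (d + 1) Lc)) Lc (KInvStep (d := d) Lc 0)) Lc l t κ Y * ((φ Y + φ (Y + unitVec κ)) * n κ Y))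
        + ∑' Y : Site (d + 1), ∑ κ, colM (coDressKBmAt (toSite (ctrOff (d + 1) Lc)) Lc (KInvStep (d := d) Lc 0)) Lc l t κ Y * (dz φ κ Y * U κ Y) := by
    have e1 : ∀ Y, (∑ κ, colM (coDressKBmAt (toSite (ctrOff (d + 1) Lc)) Lc (KInvStep (d := d) Lc 0)) Lc l t κ Y * ((φ Y + φ (Y + unitVec κ)) * contourSum Lc Hn κ Y + dz φ κ Y * U κ Y))
        = (∑ κ, colM (coDressKBmAt (toSite (ctrOff (d + 1) Lc)) Lc (KInvStep (d := d) Lc 0)) Lc l t κ Y * ((φ Y + φ (Y + unitVec κ)) * contourSum Lc Hn κ Y)) + ∑ κ, colM (coDressKBmAt (toSite (ctrOff (d + 1) Lc)) Lc (KInvStep (d := d) Lc 0)) Lc l t κ Y * (dz φ κ Y * U κ Y) := fun Y => by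
      rw [← Finset.sum_add_distrib]; exact Finset.sum_congr rfl fun κ _ => by ring
    rw [tsum_congr e1, sB1.tsum_add sB2]
    congr 1
    rw [← tsum_mul_left]
    refine tsum_congr fun Y => ?_
    rw [Finset.mul_sum]
    refine Finset.sum_congr rfl fun κ _ => ?_
    rw [eQH]; ring
  -- assemble
  have h2 := h1
  rw [show (∑' Y : Site (d + 1), ∑ κ : Fin (d + 1), (∑ κ₀, ∑' u : Site (d + 1), n κ₀ u * colM (coDressKBmAt (toSite (ctrOff (d + 1) Lc)) Lc (KInvStep (d := d) Lc 0)) Lc κ₀ u κ Y)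
        * (φ (Y + unitVec κ) * contourSum Lc (colH (coDressKBmAt (toSite (ctrOff (d + 1) Lc)) Lc (KInvStep (d := d) Lc 0)) Lc l t) κ Y
          - dz φ κ Y * ∑ b ∈ box (d + 1) Lc, ∑ s ∈ Finset.range Lc, (if b κ + s + 1 < Lc then
              colH (coDressKBmAt (toSite (ctrOff (d + 1) Lc)) Lc (KInvStep (d := d) Lc 0)) Lc l t κ ((Lc : ℤ) • Y + toSite b + (s : ℤ) • unitVec κ) else 0)))
      = (stepScale d Lc 0)⁻¹ * (φ (t + unitVec l) * Cn l t) - ∑' Y : Site (d + 1), ∑ κ, Cn κ Y * (dz φ κ Y * EIv κ Y) from eA,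
    show (∑' Y : Site (d + 1), ∑ κ : Fin (d + 1), colM (coDressKBmAt (toSite (ctrOff (d + 1) Lc)) Lc (KInvStep (d := d) Lc 0)) Lc l t κ Y * ((φ Y + φ (Y + unitVec κ))
        * contourSum Lc (fun κ'' y => ∑ κ₀, ∑' u : Site (d + 1), n κ₀ u * colH (coDressKBmAt (toSite (ctrOff (d + 1) Lc)) Lc (KInvStep (d := d) Lc 0)) Lc κ₀ u κ'' y) κ Y
        + dz φ κ Y * ((∑ b ∈ box (d + 1) Lc, ∑ s ∈ Finset.range Lc, (if Lc ≤ b κ + s then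
              (∑ κ₀, ∑' u : Site (d + 1), n κ₀ u * colH (coDressKBmAt (toSite (ctrOff (d + 1) Lc)) Lc (KInvStep (d := d) Lc 0)) Lc κ₀ u κ ((Lc : ℤ) • Y + toSite b + (s : ℤ) • unitVec κ)) else 0))
          - ∑ b ∈ box (d + 1) Lc, ∑ s ∈ Finset.range Lc, (if b κ + s + 1 < Lc then
              (∑ κ₀, ∑' u : Site (d + 1), n κ₀ u * colH (coDressKBmAt (toSite (ctrOff (d + 1) Lc)) Lc (KInvStep (d := d) Lc 0)) Lc κ₀ u κ ((Lc : ℤ) • Y + toSite b + (s : ℤ) • unitVec κ)) else 0))))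
      = (stepScale d Lc 0)⁻¹ * (∑' Y : Site (d + 1), ∑ κ, colM (coDressKBmAt (toSite (ctrOff (d + 1) Lc)) Lc (KInvStep (d := d) Lc 0)) Lc l t κ Y * ((φ Y + φ (Y + unitVec κ)) * n κ Y))
        + ∑' Y : Site (d + 1), ∑ κ, colM (coDressKBmAt (toSite (ctrOff (d + 1) Lc)) Lc (KInvStep (d := d) Lc 0)) Lc l t κ Y * (dz φ κ Y * U κ Y) from eB] at h2
  simpa only [hCn, hEIv, hU, hHn, hv] using h2

end Step

end Summit.QuantumFields.BalabanUV.Beta.GAN24.WilsonSectorSourcePairingZero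

end
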